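import Literature.Topology.FourManifolds.HomotopySpheresStablyParallelizableStability
import Literature.Topology.FourManifolds.HomotopySpheresStablyParallelizableLoops
import HarnessLib

/-!
# The boundary map of `SO(D) → SO(D + 1) → Sᴰ` by normalised lifts, and a vanishing criterion for `p_*`

Topic `Literature/Topology/FourManifolds`; second of the three sibling files `…Loops`,
`…Boundary`, `…Even` (see `HomotopySpheresStablyParallelizableLoops.lean` for the programme:
Steenrod, *The Topology of Fibre Bundles* (1951), §23.4 for even spheres, towards the named fact
`Literature.Topology.FourManifolds.Bott1959_sphereMapsToStableFramesExtend_six`). Everything here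
is PROVED; the only definitions are explicit constructions on lifts (no named facts).

For the principal bundle `p : SO(D + 1) → Sᴰ`, `p(A) = A e₀` (the tree's `SOTransport.proj`,
with fibre `ι(SO(D))`, `SOTransport.inclSO`, and the homotopy lifting theorem
`SOTransport.exists_lift` of `HomotopySpheresStablyParallelizableStability.lean`), Steenrod's
boundary operator `Δ : π_{n+1}(Sᴰ) → πₙ(SO(D))` (§17.3–17.4; Hatcher, *Algebraic Topology*
(2002), Thm. 4.41 with Prop. 4.48) is handled through **normalised lifts** of cube maps:

* §1 `projLoop f = p ∘ f` (and the homomorphism `projHom = p_*` on `π_N`), `inclLoop k = ι ∘ k`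
  on based cube loops; `SO(M)` is a topological group (`instIsTopologicalGroupSO`).
* §2 `IsJLift γ L`: `L : Iⁿ⁺¹ → SO(D + 1)` lifts the based loop `γ : (Iⁿ⁺¹, ∂) → (Sᴰ, e₀)` and is
  `1` on `J = {t₀ = 0} ∪ I × ∂Iⁿ`; `IsTop L k`: its values on the free face `{t₀ = 1}` are `ι ∘ k`
  for the based loop `k : (Iⁿ, ∂) → (SO(D), 1)` — "`Δ[γ] = [k]`" (Steenrod §17.3). Normalised lifts
  exist (`exists_isJLift`, by `exists_lift`, stationary on `∂Iⁿ`), have tops (`exists_isTop`),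
  and a based loop `f` in `SO(D + 1)` is itself a normalised lift of `p ∘ f` with top `1`
  (`isJLift_self`, `isTop_self_const`; Steenrod §17.4 "`Δ p_* = 0`").
* §3 **`Δ` is well defined** (`homotopic_top`): homotopic loops have homotopic tops, for any
  choice of normalised lifts (lift the homotopy by `exists_lift` starting from the first lift —
  stationary on `∂Iⁿ⁺¹`, so the top does not move; two normalised lifts of one loop differ by a
  map `Iⁿ⁺¹ → SO(D)` which is `1` on `J`, i.e. by a null-homotopy of the quotient of their tops).
* §4 **`Δ` and the group structures**: the glued lift `glue L L'` of a concatenation has top the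
  pointwise product of the tops (`isJLift_glue`, `isTop_glue`), the reversed lift `rev L` has top
  the pointwise inverse (`isJLift_rev`, `isTop_rev`), iterated lifts `powLift` have pointwise
  powers as tops (Steenrod §17.7: `Δ` is a homomorphism; here only on representatives).
* §5 **Exactness at `πₙ(SO(D + 1))`** (`homotopic_inclLoop_of_homotopic_const`, Steenrod §17.8 /
  Hatcher Thm. 4.41): if `p ∘ f` is null-homotopic rel `∂Iⁿ` then `f` is homotopic rel `∂Iⁿ` to a
  loop in `ι(SO(D))`.
* §6 **Vanishing criterion for `p_*`** (`homotopic_const_projLoop_of_criterion`): if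
  `π_{n+1}(Sᴰ, e₀) ≅ ℤ` and some based loop `γ` has a normalised lift whose top `T` has infinite
  order as detected by a homomorphism `μ : πₙ(SO(D), 1) → ℤ` with `μ[T] ≠ 0`, then `p ∘ f` is
  null-homotopic rel `∂Iⁿ⁺¹` for EVERY based loop `f` of `SO(D + 1)` — the abstract form of
  Steenrod's §23.4 ("`p_* = 0` in dimension `n` when `Δ` is injective on `πₙ(Sⁿ) = ℤ`"): in
  `π_{n+1}(Sᴰ) ≅ ℤ` one has `[p f]^y = [γ]^x` (`x, y` the integers of `[p f]`, `[γ]`, `y ≠ 0`);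
  comparing tops of the glued lifts gives `1 = [T]^{±x}` in `πₙ(SO(D))`, so `x = 0`. Consequences:
  `ι_*` onto `π_{n+1}(SO(D + 1), 1)` and `π_{n+1}(SO(D), 1) = 0 ⇒ π_{n+1}(SO(D + 1), 1) = 0`
  (`surjective_homotopyGroupMap_inclSO_of_criterion`,
  `subsingleton_homotopyGroup_succ_of_criterion`).

The sibling `…Even.lean` supplies, for `D = n + 1` even, the loop `γ`, its explicit normalised
lift and the homomorphism `μ = (Hurewicz) ∘ p'_*` with `μ[T] ≠ 0`.

## References

* N. Steenrod, *The Topology of Fibre Bundles*, Princeton (1951), §17 (the homotopy sequence of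
  a bundle: 17.3–17.8), §23.4. [Steenrod1951]
* A. Hatcher, *Algebraic Topology*, CUP (2002), §4.2, Thm. 4.41, Prop. 4.48, Example 4.55.
  [HatcherAT2002]
* R. Bott, *The stable homotopy of the classical groups*, Ann. of Math. 70 (1959), §1 (1.5).
  [Bott1959]
-/

noncomputable section

open scoped unitInterval Topology.Homotopy
open Matrix Set Metric Literature.AlgebraicTopology.Homotopy

namespace Literature.Topology.FourManifolds

namespace EvenSphere

open SOTransport

/-! ### 1. Projected and included loops; `SO(M)` is a topological group -/

section Basic

variable {M : ℕ} {N : Type*}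

/-- Inversion `A ↦ A⁻¹ = Aᵀ` is continuous on `SO(M)`. [folklore] -/
instance instContinuousInvSO : ContinuousInv (Matrix.specialOrthogonalGroup (Fin M) ℝ) :=
  ⟨continuous_induced_rng.2 (continuous_subtype_val.matrix_conjTranspose)⟩

/-- `SO(M)` is a topological group. [folklore] -/
instance instIsTopologicalGroupSO : IsTopologicalGroup (Matrix.specialOrthogonalGroup (Fin M) ℝ) where

/-- `ι(A⁻¹) = ι(A)⁻¹`. [folklore] -/
theorem inclSO_inv (A : Matrix.specialOrthogonalGroup (Fin M) ℝ) : inclSO A⁻¹ = (inclSO A)⁻¹ :=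
  eq_inv_of_mul_eq_one_left (by rw [← inclSO_mul, inv_mul_cancel, inclSO_one])

/-- `p(A · ι B) = p(A)`: right translation by the stabiliser does not change the projection.
[folklore] -/
theorem proj_mul_inclSO (A : Matrix.specialOrthogonalGroup (Fin (M + 1)) ℝ)
    (B : Matrix.specialOrthogonalGroup (Fin M) ℝ) : proj (A * inclSO B) = proj A := by
  rw [proj_mul, proj_inclSO, ← proj_eq_rot]

/-- `p(A⁻¹ B) = e₀` when `p A = p B`. [folklore] -/
theorem proj_inv_mul_of_proj_eq {A B : Matrix.specialOrthogonalGroup (Fin (M + 1)) ℝ}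
    (h : proj A = proj B) : proj (A⁻¹ * B) = pole M := by
  rw [proj_mul, ← h, proj_eq_rot, ← rot_mul, inv_mul_cancel, rot_one]

/-- **The projected loop** `p ∘ f : (Iᴺ, ∂Iᴺ) → (Sᴹ, e₀)` of a based loop `f` of `SO(M + 1)`
(Steenrod §17.2, `p_*`). [cite: Steenrod1951, §17.2] -/
def projLoop (f : Ω^ N (Matrix.specialOrthogonalGroup (Fin (M + 1)) ℝ) 1) :
    Ω^ N (sphere (0 : EuclideanSpace ℝ (Fin (M + 1))) 1) (pole M) :=
  ⟨⟨fun y => proj (f y), continuous_proj.comp f.1.continuous⟩, fun y hy => by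
    change proj (f y) = pole M
    rw [GenLoop.boundary f y hy, proj_one]⟩

/-- `projLoop f` pointwise. [folklore] -/
@[simp] theorem projLoop_apply (f : Ω^ N (Matrix.specialOrthogonalGroup (Fin (M + 1)) ℝ) 1)
    (y : N → I) : projLoop f y = proj (f y) := rfl

/-- `p ∘ -` preserves homotopy rel `∂Iᴺ`. [folklore] -/
theorem projLoop_homotopic {f g : Ω^ N (Matrix.specialOrthogonalGroup (Fin (M + 1)) ℝ) 1}
    (h : GenLoop.Homotopic f g) : GenLoop.Homotopic (projLoop f) (projLoop g) :=
  ContinuousMap.HomotopicRel.comp_continuousMap h ⟨proj, continuous_proj⟩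

/-- `p ∘ -` commutes with concatenation along a coordinate. [folklore] -/
theorem projLoop_transAt [DecidableEq N] (i : N)
    (f g : Ω^ N (Matrix.specialOrthogonalGroup (Fin (M + 1)) ℝ) 1) :
    projLoop (GenLoop.transAt i f g) = GenLoop.transAt i (projLoop f) (projLoop g) := by
  refine GenLoop.ext _ _ fun t => ?_
  simp only [projLoop_apply, GenLoop.transAt, GenLoop.coe_copy]
  split_ifs <;> rfl

/-- **`p_* : π_N(SO(M + 1), 1) → π_N(Sᴹ, e₀)`** as a function on classes (Steenrod §17.2).
[cite: Steenrod1951, §17.2] -/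
def projMap : HomotopyGroup N (Matrix.specialOrthogonalGroup (Fin (M + 1)) ℝ) 1 →
    HomotopyGroup N (sphere (0 : EuclideanSpace ℝ (Fin (M + 1))) 1) (pole M) :=
  Quotient.map projLoop fun _ _ h => projLoop_homotopic h

/-- `p_* ⟦f⟧ = ⟦p ∘ f⟧`. [folklore] -/
@[simp] theorem projMap_cls (f : Ω^ N (Matrix.specialOrthogonalGroup (Fin (M + 1)) ℝ) 1) :
    projMap (cls f) = cls (projLoop f) := rfl

/-- `p_*` is multiplicative (Steenrod §17.2; Hatcher p. 342). [cite: Steenrod1951, §17.2] -/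
theorem projMap_mul [DecidableEq N] [Nonempty N]
    (a b : HomotopyGroup N (Matrix.specialOrthogonalGroup (Fin (M + 1)) ℝ) 1) :
    projMap (a * b) = projMap a * projMap b := by
  obtain ⟨i⟩ := ‹Nonempty N›
  induction a using Quotient.inductionOn with
  | h p =>
    induction b using Quotient.inductionOn with
    | h q =>
      change projMap (cls p * cls q) = projMap (cls p) * projMap (cls q)
      rw [cls_mul_cls i, projMap_cls, projMap_cls, projMap_cls, cls_mul_cls i, projLoop_transAt]

/-- **`p_* : π_N(SO(M + 1), 1) →* π_N(Sᴹ, e₀)`** as a homomorphism (`N` nonempty).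
[cite: Steenrod1951, §17.2] -/
def projHom [DecidableEq N] [Nonempty N] :
    HomotopyGroup N (Matrix.specialOrthogonalGroup (Fin (M + 1)) ℝ) 1 →*
      HomotopyGroup N (sphere (0 : EuclideanSpace ℝ (Fin (M + 1))) 1) (pole M) :=
  MonoidHom.mk' projMap projMap_mul

/-- `p_* ⟦f⟧ = ⟦p ∘ f⟧`. [folklore] -/
@[simp] theorem projHom_cls [DecidableEq N] [Nonempty N]
    (f : Ω^ N (Matrix.specialOrthogonalGroup (Fin (M + 1)) ℝ) 1) :
    projHom (cls f) = cls (projLoop f) := rfl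

/-- **The included loop** `ι ∘ k : (Iᴺ, ∂Iᴺ) → (SO(M + 1), 1)` of a based loop `k` of `SO(M)`
(Steenrod §17.2, `i_*`). [cite: Steenrod1951, §17.2] -/
def inclLoop (k : Ω^ N (Matrix.specialOrthogonalGroup (Fin M) ℝ) 1) :
    Ω^ N (Matrix.specialOrthogonalGroup (Fin (M + 1)) ℝ) 1 :=
  ⟨inclSO.comp k.1, fun y hy => by
    change inclSO (k y) = 1
    rw [GenLoop.boundary k y hy, inclSO_one]⟩

/-- `inclLoop k` pointwise. [folklore] -/
@[simp] theorem inclLoop_apply (k : Ω^ N (Matrix.specialOrthogonalGroup (Fin M) ℝ) 1) (y : N → I) :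
    inclLoop k y = inclSO (k y) := rfl

/-- `ι ∘ -` preserves homotopy rel `∂Iᴺ`. [folklore] -/
theorem inclLoop_homotopic {k k' : Ω^ N (Matrix.specialOrthogonalGroup (Fin M) ℝ) 1}
    (h : GenLoop.Homotopic k k') : GenLoop.Homotopic (inclLoop k) (inclLoop k') :=
  ContinuousMap.HomotopicRel.comp_continuousMap h inclSO

/-- `ι ∘ const = const`. [folklore] -/
theorem inclLoop_const : inclLoop (GenLoop.const : Ω^ N (Matrix.specialOrthogonalGroup (Fin M) ℝ) 1)
    = GenLoop.const :=
  GenLoop.ext _ _ fun _ => inclSO_one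

/-- The class of `ι ∘ k` is `ι_*[k]` (up to the identification of base points `ι 1 = 1`): in
particular `Subsingleton`-statements transfer. We only need: if `[k] = 1` then `[ι ∘ k] = 1`.
[folklore] -/
theorem inclLoop_homotopic_const {k : Ω^ N (Matrix.specialOrthogonalGroup (Fin M) ℝ) 1}
    (h : GenLoop.Homotopic k GenLoop.const) : GenLoop.Homotopic (inclLoop k) GenLoop.const := by
  rw [← inclLoop_const]
  exact inclLoop_homotopic h

end Basic

/-! ### 2. Normalised lifts of based cube loops and their tops -/

section JLift

variable {n D : ℕ}

/-- `Function.update t 0 a = Fin.cons a (Fin.tail t)` on the cube `Iⁿ⁺¹`. [folklore] -/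
theorem update_zero_eq_cons (t : Fin (n + 1) → I) (a : I) :
    Function.update t 0 a = Fin.cons a (Fin.tail t) := by
  conv_lhs => rw [← Fin.cons_self_tail t]
  exact Fin.update_cons_zero _ _ _

/-- A point with first coordinate `0` or `1`, or with another coordinate in `{0, 1}`, lies on
`∂Iⁿ⁺¹`. [folklore] -/
theorem cons_mem_boundary_of_left {a : I} (ha : a = 0 ∨ a = 1) (y : Fin n → I) :
    (Fin.cons a y : Fin (n + 1) → I) ∈ Cube.boundary (Fin (n + 1)) :=
  ⟨0, by simpa using ha⟩

/-- A point over `∂Iⁿ` lies on `∂Iⁿ⁺¹`. [folklore] -/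
theorem cons_mem_boundary_of_right (a : I) {y : Fin n → I} (hy : y ∈ Cube.boundary (Fin n)) :
    (Fin.cons a y : Fin (n + 1) → I) ∈ Cube.boundary (Fin (n + 1)) := by
  obtain ⟨j, hj⟩ := hy
  exact ⟨j.succ, by simpa using hj⟩

/-- The set `J = {t₀ = 0} ∪ I × ∂Iⁿ ⊆ ∂Iⁿ⁺¹` on which normalised lifts are `1` (all faces but
the free face `{t₀ = 1}`; Steenrod §17.3 / Hatcher p. 343, `Jⁿ`). [cite: HatcherAT2002, §4.1 p. 343] -/
def jSet (n : ℕ) : Set (Fin (n + 1) → I) :=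
  {t | t 0 = 0 ∨ Fin.tail t ∈ Cube.boundary (Fin n)}

/-- `J ⊆ ∂Iⁿ⁺¹`. [folklore] -/
theorem jSet_subset_boundary : jSet n ⊆ Cube.boundary (Fin (n + 1)) := by
  rintro t (h | h)
  · exact ⟨0, Or.inl h⟩
  · rw [← Fin.cons_self_tail t]
    exact cons_mem_boundary_of_right _ h

/-- `Fin.cons 0 y ∈ J`. [folklore] -/
theorem cons_zero_mem_jSet (y : Fin n → I) : (Fin.cons 0 y : Fin (n + 1) → I) ∈ jSet n :=
  Or.inl (by simp)

/-- `Fin.cons a y ∈ J` for `y ∈ ∂Iⁿ`. [folklore] -/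
theorem cons_mem_jSet (a : I) {y : Fin n → I} (hy : y ∈ Cube.boundary (Fin n)) :
    (Fin.cons a y : Fin (n + 1) → I) ∈ jSet n :=
  Or.inr (by simpa using hy)

/-- **Normalised lift** of a based loop `γ : (Iⁿ⁺¹, ∂) → (Sᴰ, e₀)`: a map `L : Iⁿ⁺¹ → SO(D + 1)`
with `p ∘ L = γ` and `L = 1` on `J` (Steenrod §17.3: the lift `B → E` of a map of
`(Iⁿ⁺¹, Iⁿ, J)` used to define `Δ`). [cite: Steenrod1951, §17.3] -/
structure IsJLift (γ : Ω^ (Fin (n + 1)) (sphere (0 : EuclideanSpace ℝ (Fin (D + 1))) 1) (pole D))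
    (L : C((Fin (n + 1) → I), Matrix.specialOrthogonalGroup (Fin (D + 1)) ℝ)) : Prop where
  /-- `L` lifts `γ` through `p`. -/
  proj_eq : ∀ t, proj (L t) = γ t
  /-- `L = 1` on `J`. -/
  eq_one : ∀ t ∈ jSet n, L t = 1

/-- **Top of a lift**: on the free face `{t₀ = 1}` the lift `L` takes values in the stabiliser
`ι(SO(D))`, and `k : (Iⁿ, ∂Iⁿ) → (SO(D), 1)` records them: `ι (k y) = L(1, y)` (Steenrod
§17.3: `Δ[γ] = [k]`). [cite: Steenrod1951, §17.3] -/
def IsTop (L : C((Fin (n + 1) → I), Matrix.specialOrthogonalGroup (Fin (D + 1)) ℝ))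
    (k : Ω^ (Fin n) (Matrix.specialOrthogonalGroup (Fin D) ℝ) 1) : Prop :=
  ∀ y, inclSO (k y) = L (Fin.cons 1 y)

/-- **Every normalised lift has a top.** [cite: Steenrod1951, §17.3] -/
theorem exists_isTop {γ : Ω^ (Fin (n + 1)) (sphere (0 : EuclideanSpace ℝ (Fin (D + 1))) 1) (pole D)}
    {L : C((Fin (n + 1) → I), Matrix.specialOrthogonalGroup (Fin (D + 1)) ℝ)} (hL : IsJLift γ L) :
    ∃ k : Ω^ (Fin n) (Matrix.specialOrthogonalGroup (Fin D) ℝ) 1, IsTop L k := by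
  let F : C((Fin n → I), Matrix.specialOrthogonalGroup (Fin (D + 1)) ℝ) :=
    ⟨fun y => L (Fin.cons 1 y), L.continuous.comp (Continuous.finCons continuous_const continuous_id)⟩
  have hF : ∀ y, proj (F y) = pole D := fun y => by
    change proj (L (Fin.cons 1 y)) = pole D
    rw [hL.proj_eq]
    exact GenLoop.boundary γ _ (cons_mem_boundary_of_left (Or.inr rfl) y)
  obtain ⟨k, hk⟩ := exists_comp_inclSO_eq F hF
  refine ⟨⟨k, fun y hy => inclSO_injective ?_⟩, fun y => hk y⟩
  rw [hk, inclSO_one]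
  exact hL.eq_one _ (cons_mem_jSet 1 hy)

/-- **Normalised lifts exist** (homotopy lifting for `p : SO(D + 1) → Sᴰ`, the tree's
`SOTransport.exists_lift`, read with `t₀` as the time variable and initial lift `1`; the lift is
stationary over `∂Iⁿ`, where `γ` is constantly `e₀`). [cite: HatcherAT2002, Prop. 4.48 with Example 4.55] -/
theorem exists_isJLift (γ : Ω^ (Fin (n + 1)) (sphere (0 : EuclideanSpace ℝ (Fin (D + 1))) 1) (pole D)) :
    ∃ L : C((Fin (n + 1) → I), Matrix.specialOrthogonalGroup (Fin (D + 1)) ℝ), IsJLift γ L := by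
  let G : C(I × (Fin n → I), sphere (0 : EuclideanSpace ℝ (Fin (D + 1))) 1) :=
    ⟨fun z => γ (Fin.cons z.1 z.2), γ.1.continuous.comp (Continuous.finCons continuous_fst continuous_snd)⟩
  obtain ⟨F, hF0, hFp, hFs⟩ := exists_lift (Y := Fin n → I) G (ContinuousMap.const _ 1) fun y => by
    change proj 1 = γ (Fin.cons 0 y)
    rw [proj_one, GenLoop.boundary γ _ (cons_mem_boundary_of_left (Or.inl rfl) y)]
  refine ⟨⟨fun t => F (t 0, Fin.tail t), F.continuous.comp ((continuous_apply 0).prodMk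
    (continuous_pi fun j => continuous_apply j.succ))⟩, fun t => ?_, fun t ht => ?_⟩
  · change proj (F (t 0, Fin.tail t)) = γ t
    rw [hFp]
    change γ (Fin.cons (t 0) (Fin.tail t)) = γ t
    rw [Fin.cons_self_tail]
  · change F (t 0, Fin.tail t) = 1
    rcases ht with h | h
    · rw [h]
      exact hF0 _
    · refine hFs (Fin.tail t) (fun s => ?_) (t 0)
      change γ (Fin.cons s (Fin.tail t)) = γ (Fin.cons 0 (Fin.tail t))
      rw [GenLoop.boundary γ _ (cons_mem_boundary_of_right s h),
        GenLoop.boundary γ _ (cons_mem_boundary_of_right 0 h)]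

/-- **A based loop `f` of `SO(D + 1)` is a normalised lift of `p ∘ f`** (it is `1` on all of
`∂Iⁿ⁺¹`). [cite: Steenrod1951, §17.4] -/
theorem isJLift_self (f : Ω^ (Fin (n + 1)) (Matrix.specialOrthogonalGroup (Fin (D + 1)) ℝ) 1) :
    IsJLift (projLoop f) f.1 :=
  ⟨fun _ => rfl, fun t ht => GenLoop.boundary f t (jSet_subset_boundary ht)⟩

/-- **… with top the constant loop** ("`Δ ∘ p_* = 0`", Steenrod §17.4). [cite: Steenrod1951, §17.4] -/
theorem isTop_self_const (f : Ω^ (Fin (n + 1)) (Matrix.specialOrthogonalGroup (Fin (D + 1)) ℝ) 1) :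
    IsTop f.1 (GenLoop.const : Ω^ (Fin n) (Matrix.specialOrthogonalGroup (Fin D) ℝ) 1) := fun y => by
  rw [GenLoop.const_apply, inclSO_one]
  exact (GenLoop.boundary f _ (cons_mem_boundary_of_left (Or.inr rfl) y)).symm

/-- The constant map `1` is a normalised lift of the constant loop … [folklore] -/
theorem isJLift_const :
    IsJLift (GenLoop.const : Ω^ (Fin (n + 1)) (sphere (0 : EuclideanSpace ℝ (Fin (D + 1))) 1) (pole D))
      (ContinuousMap.const _ 1) :=
  ⟨fun _ => proj_one, fun _ _ => rfl⟩

/-- … with top the constant loop. [folklore] -/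
theorem isTop_const_const :
    IsTop (ContinuousMap.const (Fin (n + 1) → I) (1 : Matrix.specialOrthogonalGroup (Fin (D + 1)) ℝ))
      (GenLoop.const : Ω^ (Fin n) (Matrix.specialOrthogonalGroup (Fin D) ℝ) 1) := fun _ => by
  rw [GenLoop.const_apply, inclSO_one]
  rfl

end JLift

/-! ### 3. `Δ` is well defined: homotopic loops have homotopic tops -/

section Unique

variable {n D : ℕ}

/-- **Two normalised lifts of the same loop have homotopic tops.** They differ by a map
`m : Iⁿ⁺¹ → SO(D)` (`L' = L · ι m`, as `p L = p L'`), which is `1` on `J`; read with `t₀` as time,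
`k · m` is a homotopy rel `∂Iⁿ` from `k` to `k'`. [cite: Steenrod1951, §17.3] -/
theorem homotopic_top_of_same {γ : Ω^ (Fin (n + 1)) (sphere (0 : EuclideanSpace ℝ (Fin (D + 1))) 1) (pole D)}
    {L L' : C((Fin (n + 1) → I), Matrix.specialOrthogonalGroup (Fin (D + 1)) ℝ)}
    (hL : IsJLift γ L) (hL' : IsJLift γ L')
    {k k' : Ω^ (Fin n) (Matrix.specialOrthogonalGroup (Fin D) ℝ) 1} (hk : IsTop L k)
    (hk' : IsTop L' k') : GenLoop.Homotopic k k' := by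
  -- the difference `L⁻¹ L'` takes values in the stabiliser
  let Mf : C((Fin (n + 1) → I), Matrix.specialOrthogonalGroup (Fin (D + 1)) ℝ) :=
    ⟨fun t => (L t)⁻¹ * L' t, (L.continuous.inv).mul L'.continuous⟩
  have hMf : ∀ t, proj (Mf t) = pole D := fun t =>
    proj_inv_mul_of_proj_eq ((hL.proj_eq t).trans (hL'.proj_eq t).symm)
  obtain ⟨m, hm⟩ := exists_comp_inclSO_eq Mf hMf
  have hmJ : ∀ t ∈ jSet n, m t = 1 := fun t ht => inclSO_injective (by
    rw [hm, inclSO_one]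
    change (L t)⁻¹ * L' t = 1
    rw [hL.eq_one t ht, hL'.eq_one t ht, inv_one, one_mul])
  have hm1 : ∀ y, m (Fin.cons 1 y) = (k y)⁻¹ * k' y := fun y => inclSO_injective (by
    rw [hm, inclSO_mul, inclSO_inv, hk y, hk' y]
    rfl)
  refine ⟨{ toFun := fun z => k z.2 * m (Fin.cons z.1 z.2)
            continuous_toFun := (k.1.continuous.comp continuous_snd).mul
              (m.continuous.comp (Continuous.finCons continuous_fst continuous_snd))
            map_zero_left := fun y => ?_
            map_one_left := fun y => ?_
            prop' := fun t y hy => ?_ }⟩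
  · change k y * m (Fin.cons 0 y) = k y
    rw [hmJ _ (cons_zero_mem_jSet y), mul_one]
  · change k y * m (Fin.cons 1 y) = k' y
    rw [hm1, mul_inv_cancel_left]
  · change k y * m (Fin.cons t y) = k y
    rw [hmJ _ (cons_mem_jSet t hy), mul_one]

/-- **`Δ` is well defined: homotopic based loops have homotopic tops, for any choice of
normalised lifts** (Steenrod §17.3; Hatcher Thm. 4.41, via the homotopy lifting property
Prop. 4.48). *Proof.* Lift the homotopy `H : γ₀ ≃ γ₁` rel `∂Iⁿ⁺¹` by `exists_lift`, starting from
the lift `L₀` of `γ₀`; `H` is stationary on `∂Iⁿ⁺¹ ⊇ J ∪ {t₀ = 1}`, so the lifted homotopy ends in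
a normalised lift of `γ₁` with the SAME top as `L₀`, to which `homotopic_top_of_same` applies.
[cite: Steenrod1951, §17.3] [cite: HatcherAT2002, Thm. 4.41 with Prop. 4.48] -/
theorem homotopic_top {γ₀ γ₁ : Ω^ (Fin (n + 1)) (sphere (0 : EuclideanSpace ℝ (Fin (D + 1))) 1) (pole D)}
    (h : GenLoop.Homotopic γ₀ γ₁)
    {L₀ L₁ : C((Fin (n + 1) → I), Matrix.specialOrthogonalGroup (Fin (D + 1)) ℝ)}
    (hL₀ : IsJLift γ₀ L₀) (hL₁ : IsJLift γ₁ L₁)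
    {k₀ k₁ : Ω^ (Fin n) (Matrix.specialOrthogonalGroup (Fin D) ℝ) 1} (hk₀ : IsTop L₀ k₀)
    (hk₁ : IsTop L₁ k₁) : GenLoop.Homotopic k₀ k₁ := by
  obtain ⟨H⟩ := h
  obtain ⟨F, hF0, hFp, hFs⟩ := exists_lift (Y := Fin (n + 1) → I) H.toContinuousMap L₀ fun t => by
    change proj (L₀ t) = H (0, t)
    rw [H.apply_zero]
    exact hL₀.proj_eq t
  change ∀ s t, proj (F (s, t)) = H (s, t) at hFp
  change ∀ t, (∀ s, H (s, t) = H (0, t)) → ∀ s, F (s, t) = L₀ t at hFs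
  have hbd : ∀ t ∈ Cube.boundary (Fin (n + 1)), ∀ s, F (s, t) = L₀ t := fun t ht =>
    hFs t fun s => by rw [H.eq_fst s ht, H.apply_zero]
  -- the end of the lifted homotopy: a normalised lift of `γ₁` with top `k₀`
  let L₁' : C((Fin (n + 1) → I), Matrix.specialOrthogonalGroup (Fin (D + 1)) ℝ) :=
    ⟨fun t => F (1, t), F.continuous.comp (continuous_const.prodMk continuous_id)⟩
  have hL₁' : IsJLift γ₁ L₁' := ⟨fun t => by
    change proj (F (1, t)) = γ₁ t
    rw [hFp, H.apply_one]
    rfl, fun t ht => by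
    change F (1, t) = 1
    rw [hbd t (jSet_subset_boundary ht) 1, hL₀.eq_one t ht]⟩
  have hk₀' : IsTop L₁' k₀ := fun y => by
    change inclSO (k₀ y) = F (1, Fin.cons 1 y)
    rw [hbd _ (cons_mem_boundary_of_left (Or.inr rfl) y) 1, hk₀ y]
  exact homotopic_top_of_same hL₁' hL₁ hk₀' hk₁

end Unique

/-! ### 4. Glued, reversed and iterated lifts -/

section Glue

variable {n D : ℕ}

/-- Doubling the first coordinate on the lower half: `t ↦ (2t₀, t₁, …)`. [folklore] -/
def lowerArg (t : Fin (n + 1) → I) : Fin (n + 1) → I :=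
  Function.update t 0 (Set.projIcc 0 1 zero_le_one (2 * (t 0 : ℝ)))

/-- Doubling the first coordinate on the upper half: `t ↦ (2t₀ - 1, t₁, …)`. [folklore] -/
def upperArg (t : Fin (n + 1) → I) : Fin (n + 1) → I :=
  Function.update t 0 (Set.projIcc 0 1 zero_le_one (2 * (t 0 : ℝ) - 1))

/-- `lowerArg` is continuous. [folklore] -/
theorem continuous_lowerArg : Continuous (lowerArg (n := n)) :=
  continuous_id.update 0 (continuous_projIcc.comp (by fun_prop))

/-- `upperArg` is continuous. [folklore] -/
theorem continuous_upperArg : Continuous (upperArg (n := n)) :=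
  continuous_id.update 0 (continuous_projIcc.comp (by fun_prop))

/-- `tail (lowerArg t) = tail t`. [folklore] -/
@[simp] theorem tail_lowerArg (t : Fin (n + 1) → I) : Fin.tail (lowerArg t) = Fin.tail t :=
  Fin.tail_update_zero _ _

/-- `tail (upperArg t) = tail t`. [folklore] -/
@[simp] theorem tail_upperArg (t : Fin (n + 1) → I) : Fin.tail (upperArg t) = Fin.tail t :=
  Fin.tail_update_zero _ _

/-- Mathlib's concatenation along the coordinate `0`, pointwise. [folklore] -/
theorem transAt_zero_apply {X : Type*} [TopologicalSpace X] {x : X} (p q : Ω^ (Fin (n + 1)) X x)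
    (t : Fin (n + 1) → I) :
    GenLoop.transAt 0 p q t = if (t 0 : ℝ) ≤ 1 / 2 then p (lowerArg t) else q (upperArg t) := by
  simp only [GenLoop.transAt, GenLoop.coe_copy]
  rfl

/-- At the seam `t₀ = ½`: `lowerArg t` is the top point over `tail t`. [folklore] -/
theorem lowerArg_of_eq_half {t : Fin (n + 1) → I} (ht : (t 0 : ℝ) = 1 / 2) :
    lowerArg t = Fin.cons 1 (Fin.tail t) := by
  rw [lowerArg, update_zero_eq_cons, ht]
  norm_num [Set.projIcc_right]

/-- At the seam `t₀ = ½`: `upperArg t` is the bottom point over `tail t`. [folklore] -/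
theorem upperArg_of_eq_half {t : Fin (n + 1) → I} (ht : (t 0 : ℝ) = 1 / 2) :
    upperArg t = Fin.cons 0 (Fin.tail t) := by
  rw [upperArg, update_zero_eq_cons, ht]
  norm_num [Set.projIcc_left]

/-- At the bottom `t₀ = 0`: `lowerArg t` is the bottom point over `tail t`. [folklore] -/
theorem lowerArg_of_eq_zero {t : Fin (n + 1) → I} (ht : t 0 = 0) :
    lowerArg t = Fin.cons 0 (Fin.tail t) := by
  rw [lowerArg, update_zero_eq_cons, ht]
  norm_num [Set.projIcc_left]

/-- At the top `t₀ = 1`: `upperArg t` is the top point over `tail t`. [folklore] -/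
theorem upperArg_of_eq_one {t : Fin (n + 1) → I} (ht : t 0 = 1) :
    upperArg t = Fin.cons 1 (Fin.tail t) := by
  rw [upperArg, update_zero_eq_cons, ht]
  norm_num [Set.projIcc_right]

/-- **Glued lift** of a concatenation along `t₀`: the lift `L` of the first loop at double speed,
then the lift `L'` of the second loop, right-translated so as to start where `L` ended
(Steenrod §17.7, proof that `Δ` is a homomorphism). The correction `L'(0, y)⁻¹ L(1, y)` makes the
formula continuous for arbitrary `L, L'`; for normalised lifts it is `ι(k(y))`, `k` the top of `L`.
[cite: Steenrod1951, §17.7] -/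
def glue (L L' : C((Fin (n + 1) → I), Matrix.specialOrthogonalGroup (Fin (D + 1)) ℝ)) :
    C((Fin (n + 1) → I), Matrix.specialOrthogonalGroup (Fin (D + 1)) ℝ) where
  toFun t := if (t 0 : ℝ) ≤ 1 / 2 then L (lowerArg t)
    else L' (upperArg t) * ((L' (Fin.cons 0 (Fin.tail t)))⁻¹ * L (Fin.cons 1 (Fin.tail t)))
  continuous_toFun := by
    have htail : Continuous (fun t : Fin (n + 1) → I => Fin.tail t) :=
      continuous_pi fun j => continuous_apply j.succ
    refine Continuous.if_le ?_ ?_ (by fun_prop) continuous_const fun t ht => ?_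
    · exact L.continuous.comp continuous_lowerArg
    · exact (L'.continuous.comp continuous_upperArg).mul
        (((L'.continuous.comp (Continuous.finCons continuous_const htail)).inv).mul
          (L.continuous.comp (Continuous.finCons continuous_const htail)))
    · rw [lowerArg_of_eq_half ht, upperArg_of_eq_half ht, mul_inv_cancel_left]

/-- `glue` pointwise. [folklore] -/
theorem glue_apply (L L' : C((Fin (n + 1) → I), Matrix.specialOrthogonalGroup (Fin (D + 1)) ℝ))
    (t : Fin (n + 1) → I) :
    glue L L' t = if (t 0 : ℝ) ≤ 1 / 2 then L (lowerArg t)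
      else L' (upperArg t) * ((L' (Fin.cons 0 (Fin.tail t)))⁻¹ * L (Fin.cons 1 (Fin.tail t))) := rfl

/-- **The glued lift is a normalised lift of the concatenation.** [cite: Steenrod1951, §17.7] -/
theorem isJLift_glue {γ γ' : Ω^ (Fin (n + 1)) (sphere (0 : EuclideanSpace ℝ (Fin (D + 1))) 1) (pole D)}
    {L L' : C((Fin (n + 1) → I), Matrix.specialOrthogonalGroup (Fin (D + 1)) ℝ)}
    (hL : IsJLift γ L) (hL' : IsJLift γ' L') {k : Ω^ (Fin n) (Matrix.specialOrthogonalGroup (Fin D) ℝ) 1}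
    (hk : IsTop L k) : IsJLift (GenLoop.transAt 0 γ γ') (glue L L') := by
  have hcorr : ∀ t : Fin (n + 1) → I,
      (L' (Fin.cons 0 (Fin.tail t)))⁻¹ * L (Fin.cons 1 (Fin.tail t)) = inclSO (k (Fin.tail t)) := by
    intro t
    rw [hL'.eq_one _ (cons_zero_mem_jSet _), inv_one, one_mul, hk]
  refine ⟨fun t => ?_, fun t ht => ?_⟩
  · rw [transAt_zero_apply, glue_apply]
    split_ifs with h
    · exact hL.proj_eq _
    · rw [hcorr, proj_mul_inclSO, hL'.proj_eq]
  · rw [glue_apply]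
    rcases ht with h0 | hb
    · rw [if_pos (by rw [h0]; norm_num), lowerArg_of_eq_zero h0]
      exact hL.eq_one _ (cons_zero_mem_jSet _)
    · have h1 : lowerArg t ∈ jSet n := Or.inr (by rwa [tail_lowerArg])
      have h2 : upperArg t ∈ jSet n := Or.inr (by rwa [tail_upperArg])
      split_ifs with h
      · exact hL.eq_one _ h1
      · rw [hcorr, hL'.eq_one _ h2, GenLoop.boundary k _ hb, inclSO_one, one_mul]

/-- **The top of the glued lift is the pointwise product `k' · k` of the tops.**
[cite: Steenrod1951, §17.7] -/
theorem isTop_glue {γ' : Ω^ (Fin (n + 1)) (sphere (0 : EuclideanSpace ℝ (Fin (D + 1))) 1) (pole D)}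
    {L L' : C((Fin (n + 1) → I), Matrix.specialOrthogonalGroup (Fin (D + 1)) ℝ)}
    (hL' : IsJLift γ' L') {k k' : Ω^ (Fin n) (Matrix.specialOrthogonalGroup (Fin D) ℝ) 1}
    (hk : IsTop L k) (hk' : IsTop L' k') : IsTop (glue L L') (mulLoop k' k) := by
  intro y
  rw [glue_apply, if_neg (by norm_num), upperArg_of_eq_one (by simp)]
  simp only [Fin.tail_cons]
  rw [hL'.eq_one _ (cons_zero_mem_jSet _), inv_one, one_mul, ← hk, ← hk', ← inclSO_mul]
  rfl

/-- Reversal of the first coordinate: `t ↦ (1 - t₀, t₁, …)` (as in `GenLoop.symmAt 0`).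
[folklore] -/
def flipArg (t : Fin (n + 1) → I) : Fin (n + 1) → I := fun j => if j = 0 then σ (t 0) else t j

/-- `flipArg` is continuous. [folklore] -/
theorem continuous_flipArg : Continuous (flipArg (n := n)) := by
  refine continuous_pi fun j => ?_
  by_cases hj : j = 0
  · subst hj
    simp only [flipArg, if_true]
    exact unitInterval.continuous_symm.comp (continuous_apply 0)
  · simp only [flipArg, if_neg hj]
    exact continuous_apply j

/-- `flipArg t = Fin.cons (γ t₀) (tail t)`. [folklore] -/
theorem flipArg_eq_cons (t : Fin (n + 1) → I) : flipArg t = Fin.cons (σ (t 0)) (Fin.tail t) := by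
  funext j
  refine Fin.cases ?_ (fun i => ?_) j
  · simp [flipArg]
  · simp [flipArg, Fin.succ_ne_zero, Fin.tail]

/-- Mathlib's reversal along the coordinate `0`, pointwise. [folklore] -/
theorem symmAt_zero_apply {X : Type*} [TopologicalSpace X] {x : X} (p : Ω^ (Fin (n + 1)) X x)
    (t : Fin (n + 1) → I) : GenLoop.symmAt 0 p t = p (flipArg t) := rfl

/-- **Reversed lift**: `L` read backwards in `t₀`, right-translated by the inverse of its top
value so as to start at `1` (Steenrod §17.7). [cite: Steenrod1951, §17.7] -/
def rev (L : C((Fin (n + 1) → I), Matrix.specialOrthogonalGroup (Fin (D + 1)) ℝ)) :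
    C((Fin (n + 1) → I), Matrix.specialOrthogonalGroup (Fin (D + 1)) ℝ) where
  toFun t := L (flipArg t) * (L (Fin.cons 1 (Fin.tail t)))⁻¹
  continuous_toFun := (L.continuous.comp continuous_flipArg).mul
    (L.continuous.comp (Continuous.finCons continuous_const
      (continuous_pi fun j => continuous_apply j.succ))).inv

/-- `rev` pointwise. [folklore] -/
theorem rev_apply (L : C((Fin (n + 1) → I), Matrix.specialOrthogonalGroup (Fin (D + 1)) ℝ))
    (t : Fin (n + 1) → I) : rev L t = L (flipArg t) * (L (Fin.cons 1 (Fin.tail t)))⁻¹ := rfl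

/-- **The reversed lift is a normalised lift of the reversed loop.** [cite: Steenrod1951, §17.7] -/
theorem isJLift_rev {γ₀ : Ω^ (Fin (n + 1)) (sphere (0 : EuclideanSpace ℝ (Fin (D + 1))) 1) (pole D)}
    {L : C((Fin (n + 1) → I), Matrix.specialOrthogonalGroup (Fin (D + 1)) ℝ)} (hL : IsJLift γ₀ L)
    {k : Ω^ (Fin n) (Matrix.specialOrthogonalGroup (Fin D) ℝ) 1} (hk : IsTop L k) :
    IsJLift (GenLoop.symmAt 0 γ₀) (rev L) := by
  refine ⟨fun t => ?_, fun t ht => ?_⟩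
  · rw [symmAt_zero_apply, rev_apply, ← hk, proj_mul', hL.proj_eq]
  · rw [rev_apply, ← hk]
    rcases ht with h0 | hb
    · rw [flipArg_eq_cons, h0, unitInterval.symm_zero, ← hk, mul_inv_cancel]
    · rw [hL.eq_one _ (by rw [flipArg_eq_cons]; exact cons_mem_jSet _ hb), GenLoop.boundary k _ hb,
        inclSO_one, inv_one, mul_one]
where
  /-- `p(A · (ι B)⁻¹) = p(A)`. [folklore] -/
  proj_mul' {A : Matrix.specialOrthogonalGroup (Fin (D + 1)) ℝ}
      {B : Matrix.specialOrthogonalGroup (Fin D) ℝ} : proj (A * (inclSO B)⁻¹) = proj A := by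
    rw [← inclSO_inv, proj_mul_inclSO]

/-- **The top of the reversed lift is the pointwise inverse of the top.**
[cite: Steenrod1951, §17.7] -/
theorem isTop_rev {γ₀ : Ω^ (Fin (n + 1)) (sphere (0 : EuclideanSpace ℝ (Fin (D + 1))) 1) (pole D)}
    {L : C((Fin (n + 1) → I), Matrix.specialOrthogonalGroup (Fin (D + 1)) ℝ)} (hL : IsJLift γ₀ L)
    {k : Ω^ (Fin n) (Matrix.specialOrthogonalGroup (Fin D) ℝ) 1} (hk : IsTop L k) :
    IsTop (rev L) (invLoop k) := by
  intro y
  rw [rev_apply, flipArg_eq_cons]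
  simp only [Fin.cons_zero, unitInterval.symm_one, Fin.tail_cons]
  rw [hL.eq_one _ (cons_zero_mem_jSet _), one_mul, ← hk, ← inclSO_inv]
  rfl

/-- Iterated concatenation `γ^{∗j}` along `t₀` (`γ^{∗0} = const`, `γ^{∗(j+1)} = γ^{∗j} ∗ γ`), a
representative of `[γ]^j`. [folklore] -/
def loopPow {X : Type*} [TopologicalSpace X] {x : X} (p : Ω^ (Fin (n + 1)) X x) :
    ℕ → Ω^ (Fin (n + 1)) X x
  | 0 => GenLoop.const
  | j + 1 => GenLoop.transAt 0 (loopPow p j) p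

/-- `[γ^{∗j}] = [γ]^j`. [folklore] -/
theorem cls_loopPow {X : Type*} [TopologicalSpace X] {x : X} (p : Ω^ (Fin (n + 1)) X x) (j : ℕ) :
    cls (loopPow p j) = cls p ^ j := by
  induction j with
  | zero => rw [pow_zero, one_eq_cls_const]; rfl
  | succ j ih =>
    change cls (GenLoop.transAt 0 (loopPow p j) p) = cls p ^ (j + 1)
    rw [← cls_mul_cls, ih, pow_succ']

/-- Iterated glued lift (`powLift L 0 = 1`, `powLift L (j+1) = glue (powLift L j) L`).
[cite: Steenrod1951, §17.7] -/
def powLift (L : C((Fin (n + 1) → I), Matrix.specialOrthogonalGroup (Fin (D + 1)) ℝ)) :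
    ℕ → C((Fin (n + 1) → I), Matrix.specialOrthogonalGroup (Fin (D + 1)) ℝ)
  | 0 => ContinuousMap.const _ 1
  | j + 1 => glue (powLift L j) L

/-- **The iterated glued lift is a normalised lift of `γ^{∗j}` with top the pointwise power
`k^j`.** [cite: Steenrod1951, §17.7] -/
theorem isJLift_powLift_and {γ : Ω^ (Fin (n + 1)) (sphere (0 : EuclideanSpace ℝ (Fin (D + 1))) 1) (pole D)}
    {L : C((Fin (n + 1) → I), Matrix.specialOrthogonalGroup (Fin (D + 1)) ℝ)} (hL : IsJLift γ L)
    {k : Ω^ (Fin n) (Matrix.specialOrthogonalGroup (Fin D) ℝ) 1} (hk : IsTop L k) (j : ℕ) :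
    IsJLift (loopPow γ j) (powLift L j) ∧ IsTop (powLift L j) (powLoop k j) := by
  induction j with
  | zero =>
    refine ⟨isJLift_const, fun y => ?_⟩
    rw [powLoop_apply, pow_zero, inclSO_one]
    rfl
  | succ j ih =>
    refine ⟨isJLift_glue ih.1 hL ih.2, ?_⟩
    have h : powLoop k (j + 1) = mulLoop k (powLoop k j) :=
      GenLoop.ext _ _ fun y => by simp [pow_succ']
    rw [h]
    exact isTop_glue hL ih.2 hk

end Glue

/-! ### 5. Exactness at `πₙ(SO(D + 1))` -/

section Exact

variable {n D : ℕ}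

/-- **Exactness of `πₙ(SO(D)) → πₙ(SO(D + 1)) → πₙ(Sᴰ)` at the middle term** (Steenrod §17.8;
Hatcher Thm. 4.41): if `p ∘ f` is null-homotopic rel `∂Iⁿ`, then `f` is homotopic rel `∂Iⁿ` to
`ι ∘ k` for a based loop `k` of `SO(D)`. *Proof.* Transport `f` along the null-homotopy by
`exists_lift` (stationary on `∂Iⁿ`); the end lies in the stabiliser `ι(SO(D))`. This is the
argument of `SOTransport.surjective_homotopyGroupMap_inclSO` with the null-homotopy as a
hypothesis instead of `πₙ(Sᴰ) = 0`. [cite: Steenrod1951, §17.8] [cite: HatcherAT2002, Thm. 4.41 with Prop. 4.48] -/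
theorem homotopic_inclLoop_of_homotopic_const
    (f : Ω^ (Fin n) (Matrix.specialOrthogonalGroup (Fin (D + 1)) ℝ) 1)
    (h : GenLoop.Homotopic (projLoop f) GenLoop.const) :
    ∃ k : Ω^ (Fin n) (Matrix.specialOrthogonalGroup (Fin D) ℝ) 1, GenLoop.Homotopic (inclLoop k) f := by
  obtain ⟨H⟩ := h
  obtain ⟨F, hF0, hFp, hFs⟩ := exists_lift (Y := Fin n → I) H.toContinuousMap f.1 fun y => by
    change proj (f y) = H (0, y)
    rw [H.apply_zero]
    rfl
  change ∀ s y, proj (F (s, y)) = H (s, y) at hFp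
  change ∀ y, (∀ s, H (s, y) = H (0, y)) → ∀ s, F (s, y) = f y at hFs
  let f₁ : C((Fin n → I), Matrix.specialOrthogonalGroup (Fin (D + 1)) ℝ) :=
    ⟨fun y => F (1, y), F.continuous.comp (continuous_const.prodMk continuous_id)⟩
  have hf₁ : ∀ y, proj (f₁ y) = pole D := fun y => by
    change proj (F (1, y)) = pole D
    rw [hFp]
    exact H.apply_one y
  obtain ⟨k, hk⟩ := exists_comp_inclSO_eq f₁ hf₁
  have hbd : ∀ y ∈ Cube.boundary (Fin n), ∀ s, F (s, y) = f y := fun y hy =>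
    hFs y fun s => by rw [H.eq_fst s hy, H.apply_zero]
  have hkb : ∀ y ∈ Cube.boundary (Fin n), k y = 1 := fun y hy => by
    apply inclSO_injective
    rw [hk, inclSO_one]
    change F (1, y) = 1
    rw [hbd y hy 1, GenLoop.boundary f y hy]
  refine ⟨⟨k, hkb⟩, ⟨ContinuousMap.HomotopyRel.symm
    { toFun := fun p => F p
      continuous_toFun := F.continuous
      map_zero_left := fun y => hF0 y
      map_one_left := fun y => ?_
      prop' := fun s y hy => ?_ }⟩⟩
  · change F (1, y) = inclSO (k y)
    rw [hk]
    rfl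
  · exact hbd y hy s

/-- If `p ∘ f` is null-homotopic rel `∂Iⁿ` and `πₙ(SO(D), 1) = 0` then `f` is null-homotopic rel
`∂Iⁿ`. [cite: Steenrod1951, §17.8] -/
theorem homotopic_const_of_homotopic_const_projLoop
    (hD : Subsingleton (HomotopyGroup (Fin n) (Matrix.specialOrthogonalGroup (Fin D) ℝ) 1))
    (f : Ω^ (Fin n) (Matrix.specialOrthogonalGroup (Fin (D + 1)) ℝ) 1)
    (h : GenLoop.Homotopic (projLoop f) GenLoop.const) : GenLoop.Homotopic f GenLoop.const := by
  obtain ⟨k, hk⟩ := homotopic_inclLoop_of_homotopic_const f h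
  exact hk.symm.trans (inclLoop_homotopic_const ((subsingleton_homotopyGroup_iff.mp hD) k))

end Exact

/-! ### 6. The vanishing criterion for `p_*` -/

section Criterion

variable {n D : ℕ}

/-- In `Multiplicative ℤ`: `u ^ b = 1` with `u ≠ 1` forces `b = 0`. [folklore] -/
theorem int_eq_zero_of_zpow_eq_one {u : Multiplicative ℤ} (hu : u ≠ 1) {b : ℤ} (h : u ^ b = 1) :
    b = 0 :=
  eq_zero_of_zpow_eq_one (MulEquiv.refl _) hu h

/-- A representative of `[γ]^b`, `b : ℤ`, together with a normalised lift whose top is the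
pointwise power `T^b` of the top `T` of a normalised lift `Λ` of `γ`. [cite: Steenrod1951, §17.7] -/
theorem exists_rep_zpow {γ : Ω^ (Fin (n + 1)) (sphere (0 : EuclideanSpace ℝ (Fin (D + 1))) 1) (pole D)}
    {Λ : C((Fin (n + 1) → I), Matrix.specialOrthogonalGroup (Fin (D + 1)) ℝ)} (hΛ : IsJLift γ Λ)
    {T : Ω^ (Fin n) (Matrix.specialOrthogonalGroup (Fin D) ℝ) 1} (hT : IsTop Λ T) (b : ℤ) :
    ∃ (ρ : Ω^ (Fin (n + 1)) (sphere (0 : EuclideanSpace ℝ (Fin (D + 1))) 1) (pole D))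
      (L : C((Fin (n + 1) → I), Matrix.specialOrthogonalGroup (Fin (D + 1)) ℝ)),
      cls ρ = cls γ ^ b ∧ IsJLift ρ L ∧ IsTop L (zpowLoop T b) := by
  rcases le_or_gt 0 b with hb | hb
  · obtain ⟨j, rfl⟩ := Int.eq_ofNat_of_zero_le hb
    refine ⟨loopPow γ j, powLift Λ j, ?_, (isJLift_powLift_and hΛ hT j).1, ?_⟩
    · rw [cls_loopPow, zpow_natCast]
    · have h : zpowLoop T (j : ℤ) = powLoop T j := GenLoop.ext _ _ fun y => by simp
      rw [h]
      exact (isJLift_powLift_and hΛ hT j).2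
  · obtain ⟨j, hj⟩ := Int.exists_eq_neg_ofNat (le_of_lt hb)
    subst hj
    refine ⟨loopPow (GenLoop.symmAt 0 γ) j, powLift (rev Λ) j, ?_,
      (isJLift_powLift_and (isJLift_rev hΛ hT) (isTop_rev hΛ hT) j).1, ?_⟩
    · rw [cls_loopPow, ← cls_inv, inv_pow, _root_.zpow_neg, zpow_natCast]
    · have h : zpowLoop T (-(j : ℤ)) = powLoop (invLoop T) j := GenLoop.ext _ _ fun y => by
        simp [_root_.zpow_neg, zpow_natCast, inv_pow]
      rw [h]
      exact (isJLift_powLift_and (isJLift_rev hΛ hT) (isTop_rev hΛ hT) j).2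

/-- **Vanishing criterion for `p_* : π_{n+1}(SO(D + 1)) → π_{n+1}(Sᴰ)`** (the abstract core of
Steenrod §23.4). Suppose `π_{n+1}(Sᴰ, e₀) ≅ ℤ`, and some based loop `γ` of `Sᴰ` has a normalised
lift `Λ` whose top `T` satisfies `μ[T] ≠ 1` for a homomorphism `μ : πₙ(SO(D), 1) → ℤ`. Then
`p ∘ f` is null-homotopic rel `∂Iⁿ⁺¹` for every based loop `f` of `SO(D + 1)`.
*Proof.* Let `x, y ∈ ℤ` correspond to `[p f]`, `[γ]`. Then `y ≠ 0` (else `γ ≃ const`, whose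
normalised lift `1` has top `1`, so `T ≃ 1` by `homotopic_top` and `μ[T] = 1`), and
`[p f]^{|y|} = [γ]^{±x}`. The left side is represented by `(p f)^{∗|y|}` with normalised lift
`powLift f` of top `1`; the right side by a loop with a normalised lift of top `T^{±x}`
(`exists_rep_zpow`); `homotopic_top` gives `1 = [T]^{±x}` in `πₙ(SO(D))` (Eckmann–Hilton,
`cls_zpowLoop`), whence `μ[T]^{±x} = 1`, `x = 0`, `[p f] = 1`. [cite: Steenrod1951, §23.4 with §17.3–17.7] -/
theorem homotopic_const_projLoop_of_criterion [NeZero n]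
    (e : HomotopyGroup (Fin (n + 1)) (sphere (0 : EuclideanSpace ℝ (Fin (D + 1))) 1) (pole D) ≃*
      Multiplicative ℤ)
    {γ : Ω^ (Fin (n + 1)) (sphere (0 : EuclideanSpace ℝ (Fin (D + 1))) 1) (pole D)}
    {Λ : C((Fin (n + 1) → I), Matrix.specialOrthogonalGroup (Fin (D + 1)) ℝ)} (hΛ : IsJLift γ Λ)
    {T : Ω^ (Fin n) (Matrix.specialOrthogonalGroup (Fin D) ℝ) 1} (hT : IsTop Λ T)
    (μ : HomotopyGroup (Fin n) (Matrix.specialOrthogonalGroup (Fin D) ℝ) 1 →* Multiplicative ℤ)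
    (hμ : μ (cls T) ≠ 1) (f : Ω^ (Fin (n + 1)) (Matrix.specialOrthogonalGroup (Fin (D + 1)) ℝ) 1) :
    GenLoop.Homotopic (projLoop f) GenLoop.const := by
  set x : ℤ := Multiplicative.toAdd (e (cls (projLoop f))) with hx
  set y : ℤ := Multiplicative.toAdd (e (cls γ)) with hy
  -- `y ≠ 0`
  have hy0 : y ≠ 0 := by
    intro h0
    have hγ : GenLoop.Homotopic γ GenLoop.const := by
      rw [← cls_eq_one_iff]
      apply e.injective
      apply Multiplicative.toAdd.injective
      rw [← hy, h0, map_one, toAdd_one]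
    have hT1 : GenLoop.Homotopic T GenLoop.const :=
      homotopic_top hγ hΛ isJLift_const hT isTop_const_const
    exact hμ (by rw [cls_eq_one_iff.mpr hT1, map_one])
  -- the power relation, with a positive exponent on the left
  have hrel : cls (projLoop f) ^ ((y.natAbs : ℕ) : ℤ) = cls γ ^ (x * y.sign) := by
    rw [← Int.sign_mul_self_eq_natAbs, mul_comm y.sign y, _root_.zpow_mul, _root_.zpow_mul, hy,
      zpow_toAdd_eq_zpow_toAdd e (cls γ) (cls (projLoop f))]
  -- representatives with normalised lifts on both sides
  obtain ⟨ρ, L, hρ, hL, hLT⟩ := exists_rep_zpow hΛ hT (x * y.sign)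
  have hpow := isJLift_powLift_and (isJLift_self f) (isTop_self_const f) y.natAbs
  have hcls : cls (loopPow (projLoop f) y.natAbs) = cls ρ := by
    rw [cls_loopPow, hρ, ← zpow_natCast, hrel]
  have htop : GenLoop.Homotopic
      (powLoop (GenLoop.const : Ω^ (Fin n) (Matrix.specialOrthogonalGroup (Fin D) ℝ) 1) y.natAbs)
      (zpowLoop T (x * y.sign)) :=
    homotopic_top (cls_eq_cls_iff.mp hcls) hpow.1 hL hpow.2 hLT
  -- compare tops in `πₙ(SO(D))` and apply `μ`
  have h1 : cls T ^ (x * y.sign) = 1 := by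
    rw [← cls_zpowLoop, ← cls_eq_cls_iff.mpr htop, cls_powLoop, ← one_eq_cls_const, one_pow]
  have h2 : (μ (cls T)) ^ (x * y.sign) = 1 := by rw [← map_zpow, h1, map_one]
  have hx0 : x = 0 := by
    rcases mul_eq_zero.mp (int_eq_zero_of_zpow_eq_one hμ h2) with h | h
    · exact h
    · exact absurd (Int.sign_eq_zero_iff_zero.mp h) hy0
  rw [← cls_eq_one_iff]
  apply e.injective
  apply Multiplicative.toAdd.injective
  rw [← hx, hx0, map_one, toAdd_one]

/-- **Surjectivity of `ι_* : π_{n+1}(SO(D), 1) → π_{n+1}(SO(D + 1), 1)` under the criterion**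
(exactness, `homotopic_inclLoop_of_homotopic_const`, and `p_* = 0`,
`homotopic_const_projLoop_of_criterion`; Steenrod §23.4 for even spheres once `…Even.lean`
supplies the data). [cite: Steenrod1951, §23.4 with §17.8] -/
theorem surjective_homotopyGroupMap_inclSO_of_criterion [NeZero n]
    (e : HomotopyGroup (Fin (n + 1)) (sphere (0 : EuclideanSpace ℝ (Fin (D + 1))) 1) (pole D) ≃*
      Multiplicative ℤ)
    {γ : Ω^ (Fin (n + 1)) (sphere (0 : EuclideanSpace ℝ (Fin (D + 1))) 1) (pole D)}
    {Λ : C((Fin (n + 1) → I), Matrix.specialOrthogonalGroup (Fin (D + 1)) ℝ)} (hΛ : IsJLift γ Λ)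
    {T : Ω^ (Fin n) (Matrix.specialOrthogonalGroup (Fin D) ℝ) 1} (hT : IsTop Λ T)
    (μ : HomotopyGroup (Fin n) (Matrix.specialOrthogonalGroup (Fin D) ℝ) 1 →* Multiplicative ℤ)
    (hμ : μ (cls T) ≠ 1) :
    Function.Surjective (homotopyGroupMap (N := Fin (n + 1)) (inclSO (N := D)) 1) := by
  intro b
  induction b using Quotient.inductionOn with
  | h f =>
    let f' : Ω^ (Fin (n + 1)) (Matrix.specialOrthogonalGroup (Fin (D + 1)) ℝ) 1 :=
      ⟨f.1, fun y hy => (f.2 y hy).trans inclSO_one⟩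
    obtain ⟨k, hk⟩ := homotopic_inclLoop_of_homotopic_const f'
      (homotopic_const_projLoop_of_criterion e hΛ hT μ hμ f')
    exact ⟨cls k, Quotient.sound hk⟩

/-- **`π_{n+1}(SO(D), 1) = 0 ⇒ π_{n+1}(SO(D + 1), 1) = 0` under the criterion.**
[cite: Steenrod1951, §23.4 with §17.8] -/
theorem subsingleton_homotopyGroup_succ_of_criterion [NeZero n]
    (e : HomotopyGroup (Fin (n + 1)) (sphere (0 : EuclideanSpace ℝ (Fin (D + 1))) 1) (pole D) ≃*
      Multiplicative ℤ)
    {γ : Ω^ (Fin (n + 1)) (sphere (0 : EuclideanSpace ℝ (Fin (D + 1))) 1) (pole D)}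
    {Λ : C((Fin (n + 1) → I), Matrix.specialOrthogonalGroup (Fin (D + 1)) ℝ)} (hΛ : IsJLift γ Λ)
    {T : Ω^ (Fin n) (Matrix.specialOrthogonalGroup (Fin D) ℝ) 1} (hT : IsTop Λ T)
    (μ : HomotopyGroup (Fin n) (Matrix.specialOrthogonalGroup (Fin D) ℝ) 1 →* Multiplicative ℤ)
    (hμ : μ (cls T) ≠ 1)
    (hD : Subsingleton (HomotopyGroup (Fin (n + 1)) (Matrix.specialOrthogonalGroup (Fin D) ℝ) 1)) :
    Subsingleton (HomotopyGroup (Fin (n + 1)) (Matrix.specialOrthogonalGroup (Fin (D + 1)) ℝ) 1) :=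
  subsingleton_homotopyGroup_iff.mpr fun f => homotopic_const_of_homotopic_const_projLoop hD f
    (homotopic_const_projLoop_of_criterion e hΛ hT μ hμ f)

end Criterion

end EvenSphere

end Literature.Topology.FourManifolds

end
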